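import Summits.BirchSwinnertonDyer.Rank1Residual.X12.CMRamifiedReducible
import Summits.BirchSwinnertonDyer.Rank1Residual.X12.O11.RamifiedLeafInterface
import Literature.NumberTheory.EllipticCurves.ComplexMultiplicationTwistIsogenyCertProofs
import Literature.NumberTheory.EllipticCurves.IsogenyQuadraticTwistProofs
import Literature.NumberTheory.EllipticCurves.IsogenyCompProofs
import Literature.NumberTheory.EllipticCurves.QuadraticTwistJInvariantProofs
import Literature.NumberTheory.EllipticCurves.ComplexMultiplicationShaRubinRationalCMProofs
import Literature.NumberTheory.EllipticCurves.GlobalMinimalModelProofs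
import Summits.BirchSwinnertonDyer.BirchSwinnertonDyer.Theorems.RamifiedSevenEllipticUnitsStrictControlAnyPrime
import HarnessLib

/-!
# Route `PrintCFram`, crux C2 `BottomClassIndexLawFiveLe` (stmt-BirchSwinnertonDyer-20372), line
# `eisenstein-resource-bdp-line`: EVERY CM curve `W/ℚ` with `p ≥ 5` ramified in the CM field admits a
# `ℚ`-RATIONAL `p`-ISOGENY `W → W₁` onto a GLOBALLY MINIMAL curve `W₁` with `j(W₁) = j(W)`
# (cell `bsd-print-cfram`, seat `bsd-line-cfram-p1` LEAD g4; helper `--supports` 20372; 0 facts, 0 defs)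

HONEST FRAMING. Nothing about BSD is proved here. This file is the `ℚ`-side input of the per-frame
residual LINE DATA on the CM-ramified rows of the crux (the data consumed by
`stub_torsion_cmRamified_of_line`, p622599, and by the (ALG′) half of `stub_invariantMatch_cmRamified`,
p622121): the rational line `Φ = W[𝔭] ≤ W[p]` is produced as the KERNEL of an explicit `Γ_ℚ`-equivariant
map of geometric points `g : W(ℚ̄) → W₁(ℚ̄)` with `#ker g = p`, whose TARGET `W₁` is again a globally
minimal CM curve with the same `j`-invariant (hence CM-ramified at `p`, so `W₁(ℚ_p)[p] = 0` by k7r's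
`prime_nsmul_eq_zero_padic_of_hasCM_of_cmRamified`). The point of recording the target: the quotient
`W[p]/Φ` EMBEDS `Γ_ℚ`-equivariantly into `W₁[p]` through `g`, so «no decomposition group above `p` acts
trivially on `W[p]/Φ`» follows from `W₁(ℚ_p)[p] = 0` — no character theory, no `[√−p]`.

* `exists_isogeny_degree_eq_of_isogenyCert` — a checked isogeny certificate gives an `Isogeny E E'`
  over `ℚ` of degree `deg U` (the reading of `X12.not_irr_of_isogenyCert`, returning the isogeny).
* `exists_isogeny_minimal_of_j_eq` — transport to every `V/ℚ` with `j(V) = j(E)` (`j ≠ 0, 1728`):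
  `V ≅ E^{(D)}` over `ℚ` (*AEC* X.5.4), the twisted isogeny `ψ^{(D)} : E^{(D)} → E'^{(D)}` (Cremona
  §3.9, tree `Isogeny.quadraticTwist`), and a global minimal model of `E'^{(D)}` (Néron; tree
  `hasGlobalMinimalModel_rat_holds`) compose to `g : V → V₁`, `V₁` globally minimal, `j(V₁) = j(E')`,
  `deg g = deg ψ`.
* **`exists_rational_pIsogeny_of_cmRamified`** — on the leaf (`W.HasCM`, `5 ≤ p`, `CMRamified W p`;
  seven `j`-invariants, `p ∈ {7, 11, 19, 43, 67, 163}`): `∃ W₁` globally minimal elliptic with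
  `W₁.j = W.j` and `∃ g : Isogeny W W₁, g.degree = p`, from the tree's certificates
  `cert7, cert28, cert11, cert19, cert43, cert67, cert163` (isogenies `E → E^{(−p)}`).

THEOREMS ONLY; no definition, no named fact, no `sorry`; imports no `Theses` module. BSD is not proved
by any of this; no summit statement is proved by this seat.
References: [SilvermanAEC2009] III.4.8, III.4.10, X.5.4; [CremonaAlgorithms1997] §3.8–3.9;
[SilvermanATAEC1994] App. A §3; [Mazur1978] Thm. 1 (the CM points of `X₀(ℓ)(ℚ)`).
-/

set_option autoImplicit false
-- `…BirchSwinnertonDyer.BirchSwinnertonDyer.Theorems…` is the problem's mandated namespace (D-0017).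
set_option linter.dupNamespace false

noncomputable section

open scoped Classical

namespace Summit.BirchSwinnertonDyer.BirchSwinnertonDyer.Theorems.PrintCFram.RationalPIsogeny

open Polynomial WeierstrassCurve Literature.NumberTheory.EllipticCurves
  Literature.NumberTheory.EllipticCurves.PolyCert Literature.NumberTheory.EllipticCurves.CMIsogenyCert
  Literature.NumberTheory.EllipticCurves.Rank1Residual
  Summit.BirchSwinnertonDyer.Rank1Residual.X12.O11

/-! ## §1 A checked certificate is a `ℚ`-isogeny of degree `deg U` -/

/-- **A checked isogeny certificate gives an isogeny over `ℚ` of degree `deg U = |U| − 1`** (fast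
check + coprimality of `U, h` modulo a prime): *AEC* Thm. III.4.8 (`IsogenyCert.toFormula`,
`IsogenyFormula.toIsogeny`) and III.4.10 (a),(c) (`IsogenyFormula.degree_toIsogeny`). The reading of
`X12.not_irr_of_isogenyCert`, returning the isogeny itself. [cite: SilvermanAEC2009, Thm. III.4.8 and Thm. III.4.10(a),(c)] -/
theorem exists_isogeny_degree_eq_of_isogenyCert {E E' : WeierstrassCurve ℚ} [E.IsElliptic]
    [E'.IsElliptic] (c : IsogenyCert) {k : ℕ} (hc : c.checkFast k = true) (d : CoprimeCert) {k' : ℕ}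
    (hd : c.checkCoprime d k' = true) (hℓ : d.ℓ.Prime)
    (h₁ : E = ⟨c.a₁, c.a₂, c.a₃, c.a₄, c.a₆⟩) (h₂ : E' = ⟨c.a₁', c.a₂', c.a₃', c.a₄', c.a₆'⟩) :
    ∃ φ : Isogeny E E', φ.degree = c.U.length - 1 := by
  set φ := c.toFormula (IsogenyCert.check_of_checkFast hc) E E' h₁ h₂ with hφ
  have hcop : IsCoprime (φ.U.map (algebraMap ℚ (AlgebraicClosure ℚ)))
      (φ.h.map (algebraMap ℚ (AlgebraicClosure ℚ))) := by
    change IsCoprime ((ofList c.U : ℚ[X]).map (algebraMap ℚ (AlgebraicClosure ℚ)))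
      ((ofList c.h : ℚ[X]).map (algebraMap ℚ (AlgebraicClosure ℚ)))
    rw [IsogenyCert.map_ofList, IsogenyCert.map_ofList]
    exact IsogenyCert.isCoprime_of_checkCoprime hd hℓ _
  refine ⟨φ.toIsogeny, ?_⟩
  rw [φ.degree_toIsogeny hcop]
  change (ofList c.U : ℚ[X]).natDegree = c.U.length - 1
  exact IsogenyCert.natDegree_ofList_eq c.U (IsogenyCert.checkFast_spec hc).2.2.2.2.2.1

/-! ## §2 Transport along `j`: twist the isogeny, then pass to a global minimal model of the target -/

/-- The kernel of `ψ ∘ ι` for a bijective `ι` has the cardinality of the kernel of `ψ`. [folklore] -/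
theorem natCard_ker_comp_of_bijective {A B C : Type*} [AddCommGroup A] [AddCommGroup B]
    [AddCommGroup C] (ψ : B →+ C) (ι : A →+ B) (hι : Function.Bijective ι) :
    Nat.card (ψ.comp ι).ker = Nat.card ψ.ker := by
  refine Nat.card_congr
    { toFun := fun x ↦ ⟨ι x.1, by
        have hx := x.2
        rw [AddMonoidHom.mem_ker, AddMonoidHom.comp_apply] at hx
        exact hx⟩
      invFun := fun y ↦ ⟨(Equiv.ofBijective ι hι).symm y.1, by
        rw [AddMonoidHom.mem_ker, AddMonoidHom.comp_apply]
        have h1 : ι ((Equiv.ofBijective ι hι).symm y.1) = y.1 :=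
          (Equiv.ofBijective ι hι).apply_symm_apply y.1
        rw [h1]
        exact y.2⟩
      left_inv := fun x ↦ Subtype.ext ((Equiv.ofBijective ι hι).symm_apply_apply x.1)
      right_inv := fun y ↦ Subtype.ext ((Equiv.ofBijective ι hι).apply_symm_apply y.1) }

/-- The kernel of `ι ∘ ψ` for an injective `ι` is the kernel of `ψ`. [folklore] -/
theorem ker_comp_of_injective {A B C : Type*} [AddCommGroup A] [AddCommGroup B]
    [AddCommGroup C] (ι : B →+ C) (ψ : A →+ B) (hι : Function.Injective ι) :
    (ι.comp ψ).ker = ψ.ker := by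
  ext x
  rw [AddMonoidHom.mem_ker, AddMonoidHom.mem_ker, AddMonoidHom.comp_apply]
  constructor
  · intro h
    exact hι (by rw [h, map_zero])
  · intro h
    rw [h, map_zero]

/-- **Transport of a `ℚ`-isogeny along the `j`-invariant, with a globally minimal target.** Let
`ψ : E → E'` be an isogeny over `ℚ` between short models (`a₁ = a₃ = 0`) with `j(E) ≠ 0, 1728`, and
`V/ℚ` any elliptic curve with `j(V) = j(E)`. Then there is a GLOBALLY MINIMAL elliptic `V₁/ℚ` with
`j(V₁) = j(E')` and an isogeny `g : V → V₁` over `ℚ` with `deg g = deg ψ`: `C • V = E^{(D)}` for some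
`D ∈ ℚ^×` (*AEC* X.5.4, `exists_variableChange_eq_quadraticTwist_of_j_eq`), the twisted isogeny
`ψ^{(D)} : E^{(D)} → E'^{(D)}` has the same degree (`Isogeny.degree_quadraticTwist`), and `E'^{(D)}` has
a global minimal model `C' • E'^{(D)}` (Néron, `hasGlobalMinimalModel_rat_holds`); the `ℚ`-isomorphisms
are bijective isogenies (`Rubin1987.exists_isogeny_bijective_of_smul_eq`).
[cite: SilvermanAEC2009, X.5 Prop. 5.4 and Cor. 5.4.1; VIII.8 (global minimal models)]
[cite: CremonaAlgorithms1997, §3.9 (p. 87) (twisting commutes with isogenies)] -/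
theorem exists_isogeny_minimal_of_j_eq {E E' : WeierstrassCurve ℚ} [E.IsElliptic] [E'.IsElliptic]
    [E.IsCharNeTwoNF] [E'.IsCharNeTwoNF] (h0 : E.j ≠ 0) (h1728 : E.j ≠ 1728) (ψ : Isogeny E E')
    (V : WeierstrassCurve ℚ) [V.IsElliptic] (hj : V.j = E.j) :
    ∃ (V₁ : WeierstrassCurve ℚ) (_ : V₁.IsElliptic) (_ : V₁.IsGloballyMinimal),
      V₁.j = E'.j ∧ ∃ g : Isogeny V V₁, g.degree = ψ.degree := by
  haveI : NeZero (2 : ℚ) := ⟨two_ne_zero⟩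
  obtain ⟨D, hD, C, hC⟩ := exists_variableChange_eq_quadraticTwist_of_j_eq hj h0 h1728
  haveI hED : (E.quadraticTwist D).IsElliptic := isElliptic_quadraticTwist E hD
  haveI hE'D : (E'.quadraticTwist D).IsElliptic := isElliptic_quadraticTwist E' hD
  obtain ⟨ι, hι⟩ := Rubin1987.exists_isogeny_bijective_of_smul_eq C hC
  set ψD := ψ.quadraticTwist hD with hψD
  obtain ⟨C', hC'⟩ := hasGlobalMinimalModel_rat_holds (E'.quadraticTwist D)
  obtain ⟨ι', hι'⟩ := Rubin1987.exists_isogeny_bijective_of_smul_eq (V := E'.quadraticTwist D) C' rfl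
  refine ⟨C' • E'.quadraticTwist D, inferInstance, hC', ?_, ι'.comp (ψD.comp ι), ?_⟩
  · rw [variableChange_j, j_quadraticTwist E' hD]
  · unfold Isogeny.degree
    change Nat.card (ι'.toAddMonoidHom.comp (ψD.toAddMonoidHom.comp ι.toAddMonoidHom)).ker = _
    rw [ker_comp_of_injective _ _ hι'.1, natCard_ker_comp_of_bijective _ _ hι]
    exact Isogeny.degree_quadraticTwist ψ hD

/-! ## §3 The leaf: a rational `p`-isogeny onto a globally minimal curve with the same `j` -/

section Leaf

variable (W : WeierstrassCurve ℚ) [W.IsElliptic] (p : ℕ) [hp : Fact p.Prime]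

/-- Short models `⟨0, 0, 0, a₄, a₆⟩` have `a₁ = a₃ = 0`. [folklore] -/
theorem isCharNeTwoNF_short (a₄ a₆ : ℚ) : (⟨0, 0, 0, a₄, a₆⟩ : WeierstrassCurve ℚ).IsCharNeTwoNF :=
  ⟨rfl, rfl⟩

/-- **A RATIONAL `p`-ISOGENY ON THE LEAF, onto a globally minimal curve with the same `j`.** For `W/ℚ`
with CM and `p ≥ 5` ramified in the CM field (`CMRamified W p`; then `p ∈ {7, 11, 19, 43, 67, 163}` and
`j(W)` is one of the seven leaf invariants) there are a GLOBALLY MINIMAL elliptic `W₁/ℚ` with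
`j(W₁) = j(W)` — so `W₁` has CM and is CM-ramified at `p` as well — and an isogeny `g : W → W₁` over `ℚ`
of degree `p` (`#ker g = p`): the certified isogenies `E → E^{(−p)}` of the seven models (kernel
`E[√−p] = E[𝔭]`; `cert7`, `cert28`, `cert11`, `cert19`, `cert43`, `cert67`, `cert163`) transported
along `j` by §2. Classically these are the CM points of `X₀(p)(ℚ)` (Mazur).
[cite: SilvermanATAEC1994, App. A §3 (table of CM j-invariants)] [cite: Mazur1978, Thm. 1 (pp. 129–130)]
[cite: CremonaAlgorithms1997, §3.8 (p. 82)] -/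
theorem exists_rational_pIsogeny_of_cmRamified (hCM : W.HasCM) (h5 : 5 ≤ p) (hram : CMRamified W p) :
    ∃ (W₁ : WeierstrassCurve ℚ) (_ : W₁.IsElliptic) (_ : W₁.IsGloballyMinimal),
      W₁.j = W.j ∧ ∃ g : Isogeny W W₁, g.degree = p := by
  have hj13 : W.j ∈ cmJInvariants := (hasCM_iff_j_mem_holds W).mp hCM
  obtain ⟨-, hd, -⟩ := LeafInterface.leaf_arith W p hCM h5 hram
  simp only [cmJInvariants, Finset.mem_insert, Finset.mem_singleton] at hj13
  rcases hj13 with h | h | h | h | h | h | h | h | h | h | h | h | h <;>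
    rw [h] at hd <;> norm_num [cmFieldDiscrOfJ] at hd
  -- `d_K ∈ {-3, -4}` contradicts `5 ≤ p`; eight `j` remain
  all_goals first | (exfalso; omega) | skip
  · -- j = -3375 (p = 7), `cert7`
    obtain rfl : p = 7 := by omega
    haveI := isElliptic_cert7
    haveI := isElliptic_cert7'
    haveI := isCharNeTwoNF_short (-2835) (-71442)
    haveI := isCharNeTwoNF_short (-138915) 24504606
    obtain ⟨ψ, hψ⟩ := exists_isogeny_degree_eq_of_isogenyCert
      (E := (⟨0, 0, 0, -2835, -71442⟩ : WeierstrassCurve ℚ))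
      (E' := (⟨0, 0, 0, -138915, 24504606⟩ : WeierstrassCurve ℚ)) cert7 checkFast_cert7 cert7Cop
      checkCoprime_cert7 (by rw [show cert7Cop.ℓ = 10007 from rfl]; norm_num)
      (by rw [cert7_a₁, cert7_a₂, cert7_a₃, cert7_a₄, cert7_a₆]; norm_num)
      (by rw [cert7_a₁', cert7_a₂', cert7_a₃', cert7_a₄', cert7_a₆']; norm_num)
    have hjE : (⟨0, 0, 0, -2835, -71442⟩ : WeierstrassCurve ℚ).j = -3375 := j_cert7 rfl
    have hjE' : (⟨0, 0, 0, -138915, 24504606⟩ : WeierstrassCurve ℚ).j = -3375 := by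
      rw [j_eq_c₄_pow_three_div_Δ]
      norm_num [WeierstrassCurve.c₄, WeierstrassCurve.Δ, WeierstrassCurve.b₂, WeierstrassCurve.b₄,
        WeierstrassCurve.b₆, WeierstrassCurve.b₈]
    obtain ⟨V₁, _, _, hjV₁, g, hg⟩ := exists_isogeny_minimal_of_j_eq (by rw [hjE]; norm_num)
      (by rw [hjE]; norm_num) ψ W (by rw [h, hjE])
    exact ⟨V₁, ‹_›, ‹_›, by rw [hjV₁, hjE', h], g, by rw [hg, hψ]; rfl⟩
  · -- j = 8000: `d_K = -8 = -p` is impossible for a prime `p`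
    exfalso
    have hp8 : p = 8 := by omega
    exact absurd hp.out (by rw [hp8]; norm_num)
  · -- j = -32768, p = 11, `cert11`
    obtain rfl : p = 11 := by omega
    haveI := isElliptic_cert11
    haveI := isElliptic_cert11'
    haveI := isCharNeTwoNF_short (-9504) 365904
    haveI := isCharNeTwoNF_short (-1149984) (-487018224)
    obtain ⟨ψ, hψ⟩ := exists_isogeny_degree_eq_of_isogenyCert
      (E := (⟨0, 0, 0, -9504, 365904⟩ : WeierstrassCurve ℚ))
      (E' := (⟨0, 0, 0, -1149984, -487018224⟩ : WeierstrassCurve ℚ)) cert11 checkFast_cert11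
      cert11Cop checkCoprime_cert11 (by rw [cert11Cop_ℓ]; norm_num)
      (by rw [cert11_a₁, cert11_a₂, cert11_a₃, cert11_a₄, cert11_a₆]; norm_num)
      (by rw [cert11_a₁', cert11_a₂', cert11_a₃', cert11_a₄', cert11_a₆']; norm_num)
    have hjE : (⟨0, 0, 0, -9504, 365904⟩ : WeierstrassCurve ℚ).j = -32768 := j_cert11 rfl
    have hjE' : (⟨0, 0, 0, -1149984, -487018224⟩ : WeierstrassCurve ℚ).j = -32768 := j_cert11' rfl
    obtain ⟨V₁, _, _, hjV₁, g, hg⟩ := exists_isogeny_minimal_of_j_eq (by rw [hjE]; norm_num)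
      (by rw [hjE]; norm_num) ψ W (by rw [h, hjE])
    exact ⟨V₁, ‹_›, ‹_›, by rw [hjV₁, hjE', h], g, by rw [hg, hψ]; rfl⟩
  · -- j = -884736, p = 19, `cert19`
    obtain rfl : p = 19 := by omega
    haveI := isElliptic_cert19
    haveI := isElliptic_cert19'
    haveI := isCharNeTwoNF_short (-608) 5776
    haveI := isCharNeTwoNF_short (-219488) (-39617584)
    obtain ⟨ψ, hψ⟩ := exists_isogeny_degree_eq_of_isogenyCert
      (E := (⟨0, 0, 0, -608, 5776⟩ : WeierstrassCurve ℚ))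
      (E' := (⟨0, 0, 0, -219488, -39617584⟩ : WeierstrassCurve ℚ)) cert19 checkFast_cert19
      cert19Cop checkCoprime_cert19 (by rw [cert19Cop_ℓ]; norm_num)
      (by rw [cert19_a₁, cert19_a₂, cert19_a₃, cert19_a₄, cert19_a₆]; norm_num)
      (by rw [cert19_a₁', cert19_a₂', cert19_a₃', cert19_a₄', cert19_a₆']; norm_num)
    have hjE : (⟨0, 0, 0, -608, 5776⟩ : WeierstrassCurve ℚ).j = -884736 := j_cert19 rfl
    have hjE' : (⟨0, 0, 0, -219488, -39617584⟩ : WeierstrassCurve ℚ).j = -884736 := j_cert19' rfl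
    obtain ⟨V₁, _, _, hjV₁, g, hg⟩ := exists_isogeny_minimal_of_j_eq (by rw [hjE]; norm_num)
      (by rw [hjE]; norm_num) ψ W (by rw [h, hjE])
    exact ⟨V₁, ‹_›, ‹_›, by rw [hjV₁, hjE', h], g, by rw [hg, hψ]; rfl⟩
  · -- j = 16581375, p = 7, the order `ℤ[√−7]`, `cert28`
    obtain rfl : p = 7 := by omega
    haveI := isElliptic_cert28
    haveI := isElliptic_cert28'
    haveI := isCharNeTwoNF_short (-48195) (-4072194)
    haveI := isCharNeTwoNF_short (-2361555) 1396762542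
    obtain ⟨ψ, hψ⟩ := exists_isogeny_degree_eq_of_isogenyCert
      (E := (⟨0, 0, 0, -48195, -4072194⟩ : WeierstrassCurve ℚ))
      (E' := (⟨0, 0, 0, -2361555, 1396762542⟩ : WeierstrassCurve ℚ)) cert28 checkFast_cert28
      cert28Cop checkCoprime_cert28 (by rw [cert28Cop_ℓ]; norm_num)
      (by rw [cert28_a₁, cert28_a₂, cert28_a₃, cert28_a₄, cert28_a₆]; norm_num)
      (by rw [cert28_a₁', cert28_a₂', cert28_a₃', cert28_a₄', cert28_a₆']; norm_num)
    have hjE : (⟨0, 0, 0, -48195, -4072194⟩ : WeierstrassCurve ℚ).j = 16581375 := j_cert28 rfl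
    have hjE' : (⟨0, 0, 0, -2361555, 1396762542⟩ : WeierstrassCurve ℚ).j = 16581375 := j_cert28' rfl
    obtain ⟨V₁, _, _, hjV₁, g, hg⟩ := exists_isogeny_minimal_of_j_eq (by rw [hjE]; norm_num)
      (by rw [hjE]; norm_num) ψ W (by rw [h, hjE])
    exact ⟨V₁, ‹_›, ‹_›, by rw [hjV₁, hjE', h], g, by rw [hg, hψ]; rfl⟩
  · -- j = -884736000, p = 43, `cert43`
    obtain rfl : p = 43 := by omega
    haveI := isElliptic_cert43
    haveI := isElliptic_cert43'
    haveI := isCharNeTwoNF_short (-13760) 621264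
    haveI := isCharNeTwoNF_short (-25442240) (-49394836848)
    obtain ⟨ψ, hψ⟩ := exists_isogeny_degree_eq_of_isogenyCert
      (E := (⟨0, 0, 0, -13760, 621264⟩ : WeierstrassCurve ℚ))
      (E' := (⟨0, 0, 0, -25442240, -49394836848⟩ : WeierstrassCurve ℚ)) cert43 checkFast_cert43
      cert43Cop checkCoprime_cert43 (by rw [cert43Cop_ℓ]; norm_num)
      (by rw [cert43_a₁, cert43_a₂, cert43_a₃, cert43_a₄, cert43_a₆]; norm_num)
      (by rw [cert43_a₁', cert43_a₂', cert43_a₃', cert43_a₄', cert43_a₆']; norm_num)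
    have hjE : (⟨0, 0, 0, -13760, 621264⟩ : WeierstrassCurve ℚ).j = -884736000 := j_cert43 rfl
    have hjE' : (⟨0, 0, 0, -25442240, -49394836848⟩ : WeierstrassCurve ℚ).j = -884736000 :=
      j_cert43' rfl
    obtain ⟨V₁, _, _, hjV₁, g, hg⟩ := exists_isogeny_minimal_of_j_eq (by rw [hjE]; norm_num)
      (by rw [hjE]; norm_num) ψ W (by rw [h, hjE])
    exact ⟨V₁, ‹_›, ‹_›, by rw [hjV₁, hjE', h], g, by rw [hg, hψ]; rfl⟩
  · -- j = -147197952000, p = 67, `cert67`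
    obtain rfl : p = 67 := by omega
    haveI := isElliptic_cert67
    haveI := isElliptic_cert67'
    haveI := isCharNeTwoNF_short (-117920) 15585808
    haveI := isCharNeTwoNF_short (-529342880) (-4687634371504)
    obtain ⟨ψ, hψ⟩ := exists_isogeny_degree_eq_of_isogenyCert
      (E := (⟨0, 0, 0, -117920, 15585808⟩ : WeierstrassCurve ℚ))
      (E' := (⟨0, 0, 0, -529342880, -4687634371504⟩ : WeierstrassCurve ℚ)) cert67 checkFast_cert67
      cert67Cop checkCoprime_cert67 (by rw [cert67Cop_ℓ]; norm_num)
      (by rw [cert67_a₁, cert67_a₂, cert67_a₃, cert67_a₄, cert67_a₆]; norm_num)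
      (by rw [cert67_a₁', cert67_a₂', cert67_a₃', cert67_a₄', cert67_a₆']; norm_num)
    have hjE : (⟨0, 0, 0, -117920, 15585808⟩ : WeierstrassCurve ℚ).j = -147197952000 := j_cert67 rfl
    have hjE' : (⟨0, 0, 0, -529342880, -4687634371504⟩ : WeierstrassCurve ℚ).j = -147197952000 :=
      j_cert67' rfl
    obtain ⟨V₁, _, _, hjV₁, g, hg⟩ := exists_isogeny_minimal_of_j_eq (by rw [hjE]; norm_num)
      (by rw [hjE]; norm_num) ψ W (by rw [h, hjE])
    exact ⟨V₁, ‹_›, ‹_›, by rw [hjV₁, hjE', h], g, by rw [hg, hψ]; rfl⟩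
  · -- j = -262537412640768000, p = 163, `cert163`
    obtain rfl : p = 163 := by omega
    haveI := isElliptic_cert163
    haveI := isElliptic_cert163'
    haveI := isCharNeTwoNF_short (-34790720) 78984748304
    haveI := isCharNeTwoNF_short (-924354639680) (-342062961763303088)
    obtain ⟨ψ, hψ⟩ := exists_isogeny_degree_eq_of_isogenyCert
      (E := (⟨0, 0, 0, -34790720, 78984748304⟩ : WeierstrassCurve ℚ))
      (E' := (⟨0, 0, 0, -924354639680, -342062961763303088⟩ : WeierstrassCurve ℚ)) cert163
      checkFast_cert163 cert163Cop checkCoprime_cert163 (by rw [cert163Cop_ℓ]; norm_num)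
      (by rw [cert163_a₁, cert163_a₂, cert163_a₃, cert163_a₄, cert163_a₆]; norm_num)
      (by rw [cert163_a₁', cert163_a₂', cert163_a₃', cert163_a₄', cert163_a₆']; norm_num)
    have hjE : (⟨0, 0, 0, -34790720, 78984748304⟩ : WeierstrassCurve ℚ).j = -262537412640768000 :=
      j_cert163 rfl
    have hjE' : (⟨0, 0, 0, -924354639680, -342062961763303088⟩ : WeierstrassCurve ℚ).j =
        -262537412640768000 := j_cert163' rfl
    obtain ⟨V₁, _, _, hjV₁, g, hg⟩ := exists_isogeny_minimal_of_j_eq (by rw [hjE]; norm_num)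
      (by rw [hjE]; norm_num) ψ W (by rw [h, hjE])
    -- `deg U = 163` by kernel evaluation (as in `X12.not_irr_oneSixtyThree_certModel163`)
    exact ⟨V₁, ‹_›, ‹_›, by rw [hjV₁, hjE', h], g, by
      rw [hg, hψ]; exact (show cert163.U.length - 1 = 163 by decide +kernel)⟩

/-- **Corollary: the target is CM-ramified too, and has no `ℚ_p`-rational `p`-torsion.** On the leaf,
with `W₁` as in `exists_rational_pIsogeny_of_cmRamified`: `W₁.HasCM`, `CMRamified W₁ p` (both are
functions of `j`), hence `W₁(ℚ_p)[p] = 0` by k7r's `prime_nsmul_eq_zero_padic_of_hasCM_of_cmRamified`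
(Mazur's local step at the additive prime `p`). [cite: Mazur1977, Ch. III §5, Step 1, p. 158]
[cite: SilvermanATAEC1994, App. A §3] -/
theorem exists_rational_pIsogeny_noPTorsionPadic_of_cmRamified (hCM : W.HasCM) (h5 : 5 ≤ p)
    (hram : CMRamified W p) :
    ∃ (W₁ : WeierstrassCurve ℚ) (_ : W₁.IsElliptic) (_ : W₁.IsGloballyMinimal),
      W₁.HasCM ∧ CMRamified W₁ p ∧
      (∀ R : (W₁.baseChange ℚ_[p]).toAffine.Point, p • R = 0 → R = 0) ∧
      ∃ g : Isogeny W W₁, g.degree = p := by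
  obtain ⟨W₁, _, _, hj, g, hg⟩ := exists_rational_pIsogeny_of_cmRamified W p hCM h5 hram
  have hCM₁ : W₁.HasCM := (hasCM_iff_j_mem_holds W₁).mpr (hj ▸ (hasCM_iff_j_mem_holds W).mp hCM)
  have hram₁ : CMRamified W₁ p := by
    unfold CMRamified at hram ⊢
    rw [hj]
    exact hram
  exact ⟨W₁, ‹_›, ‹_›, hCM₁, hram₁,
    Summit.BirchSwinnertonDyer.BirchSwinnertonDyer.Theorems.RamifiedSevenEllipticUnits.prime_nsmul_eq_zero_padic_of_hasCM_of_cmRamified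
      W₁ p hCM₁ h5 hram₁, g, hg⟩

end Leaf

end Summit.BirchSwinnertonDyer.BirchSwinnertonDyer.Theorems.PrintCFram.RationalPIsogeny

end
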